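import Mathlib
import HarnessLib
import Summits.Ventures.LatticeQCDFlow.Exactness.SU2KickPositiveJacobian
import Summits.Ventures.LatticeQCDFlow.Exactness.WilsonFlowMasks
import Summits.Ventures.LatticeQCDFlow.Exactness.U1MaskedLayerCircleMap

/-!
# The engine's zero-parameter member on the `SU(2)` rung: the masked Euler sub-step of the `SU(2)` Wilson flow (quaternion form) is a certified coupling layer of `GaugeConfig d L SU(2)` for the product Haar measure

HONEST FRAMING: exact (Metropolis-corrected) sampling algorithms for lattice gauge theory;
figures of merit are autocorrelation/cost numbers at stated couplings and volumes; no
continuum-physics claim.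

Venture `LatticeQCDFlow` (cell pub-lqcd), topic `Exactness`; FANOUT row 14 (`eng-flowhmc`, engine
`latflow.fthmc`, family B; member `maps.wilson_flow_lo`; the row's acceptance configuration is
4⁴ `SU(2)`).  NEW WORK of the cell; nothing is cited as a fact; no number.  The `SU(2)` twin of
`U1WilsonFlowLOSubstep`: the sub-step `(μ, class b)` of the masked Euler integration of the `SU(2)`
Wilson flow replaces every link `U = V(x, μ)` with `χ x = b` (`χ` a proper colouring) by the kick
towards the conjugate staple sum, `U ↦ gaussUnit (geodesicKick ε J_{x,μ}(V) (vecQuat U))` with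
`J_{x,μ}(V) = Σ_{ν ≠ μ} [vecQuat (A_ν⁻¹) + vecQuat (B_ν⁻¹)]`, `A_ν = V(x+μ̂,ν) V(x+ν̂,μ)⁻¹ V(x,ν)⁻¹`,
`B_ν = V(x+μ̂−ν̂,ν)⁻¹ V(x−ν̂,μ)⁻¹ V(x−ν̂,ν)` (so `J = vecQuat R†` for the staple sum
`R = Σ_ν (A_ν + B_ν)`; in quaternion coordinates this is `U ↦ exp(−ε P(U R)) U`, see
`SU2KickJacobian`), all other links unchanged, booking the repaired per-link density of
`SU2KickPositiveJacobian`.  Refusal rule: `2(d−1)|ε| < 1` (then `|ε| ‖J‖ < 1` as `‖J‖ ≤ 2(d−1)`).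

## Content (statements about explicit expressions; no definition is introduced)

* `stapleJ_local` (the field `J` at an active link is a function of the frozen links —
  `WilsonFlowMasks.links_eq_of_frozen_eq`), `norm_stapleJ_le` (`‖J‖ ≤ 2(d−1)`), `continuous_stapleJ`.
* **`su2WilsonFlowLOSubstep_certified`** — for a proper colouring `χ`, any `μ`, `b` and
  `2(d−1)|ε| < 1`: the sub-step, computed from the full field, is MEASURABLE, BIJECTIVE, and has
  `HasJacobian (⊗_e haarProbability SU(2)) _ (∏_active j̃)` with the product of the repaired
  per-link densities, POSITIVE and measurable (`Theory2.coupleFun` / `hasJacobian_coupleFun`,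
  `hasJacobian_su2Kick_fix`, `bijective_su2Kick`, `bijective_maskedLayer`).

NOT here: the measurable-equivalence packaging and FT-HMC (next file); the typed identity with
the matrix-exponential form; `SU(N ≥ 3)`; any number.
-/

noncomputable section

namespace Summit.Ventures.LatticeQCDFlow.Exactness

open Real Set MeasureTheory Measure InnerProductGeometry Metric
open Literature.MathematicalPhysics.QuantumFieldTheory Summit.Ventures.LatticeQCDFlow.Theory2
open scoped ENNReal

variable {d L : ℕ} {X : Type*}

/-! ## The conjugate-staple field -/

section Staple

/-- **The field `J` at an active link is frozen**: if `V`, `W` agree off the active class then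
`J_e(V) = J_e(W)` at every active `e`. -/
theorem stapleJ_local (χ : Site d L → X) (hχ : ∀ (x : Site d L) (i : Fin d), χ (x.shift i) ≠ χ x)
    {μ : Fin d} {b : X} {V W : GaugeConfig d L ((Matrix.specialUnitaryGroup (Fin 2) ℂ))}
    {e : Edge d L} (he : e.2 = μ ∧ χ e.1 = b)
    (hVW : ∀ j : Edge d L, ¬(j.2 = μ ∧ χ j.1 = b) → V j = W j) :
    (∑ ν ∈ Finset.univ.erase e.2,
            (vecQuat (((V (Site.shift e.1 e.2, ν) * (V (Site.shift e.1 ν, e.2))⁻¹ * (V (e.1, ν))⁻¹)⁻¹ : (Matrix.specialUnitaryGroup (Fin 2) ℂ)) : Matrix (Fin 2) (Fin 2) ℂ) +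
              vecQuat ((((V (Site.shift (e.1 - Pi.single ν 1) e.2, ν))⁻¹ * (V (e.1 - Pi.single ν 1, e.2))⁻¹ * V (e.1 - Pi.single ν 1, ν))⁻¹ : (Matrix.specialUnitaryGroup (Fin 2) ℂ)) : Matrix (Fin 2) (Fin 2) ℂ))) =
      ∑ ν ∈ Finset.univ.erase e.2,
            (vecQuat (((W (Site.shift e.1 e.2, ν) * (W (Site.shift e.1 ν, e.2))⁻¹ * (W (e.1, ν))⁻¹)⁻¹ : (Matrix.specialUnitaryGroup (Fin 2) ℂ)) : Matrix (Fin 2) (Fin 2) ℂ) +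
              vecQuat ((((W (Site.shift (e.1 - Pi.single ν 1) e.2, ν))⁻¹ * (W (e.1 - Pi.single ν 1, e.2))⁻¹ * W (e.1 - Pi.single ν 1, ν))⁻¹ : (Matrix.specialUnitaryGroup (Fin 2) ℂ)) : Matrix (Fin 2) (Fin 2) ℂ)) := by
  obtain ⟨x, μ'⟩ := e
  obtain ⟨rfl, hx⟩ := he
  refine Finset.sum_congr rfl fun ν hν => ?_
  obtain ⟨h1, h2, h3, h4, h5, h6⟩ := links_eq_of_frozen_eq χ hχ hVW hx (Finset.ne_of_mem_erase hν)
  rw [h1, h2, h3, h4, h5, h6]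

/-- `‖J_e(W)‖ ≤ 2(d−1)`: each of the `2(d−1)` conjugate staples is an `SU(2)` element, of unit
length in quaternion coordinates. -/
theorem norm_stapleJ_le (W : GaugeConfig d L ((Matrix.specialUnitaryGroup (Fin 2) ℂ))) (e : Edge d L) :
    ‖∑ ν ∈ Finset.univ.erase e.2,
            (vecQuat (((W (Site.shift e.1 e.2, ν) * (W (Site.shift e.1 ν, e.2))⁻¹ * (W (e.1, ν))⁻¹)⁻¹ : (Matrix.specialUnitaryGroup (Fin 2) ℂ)) : Matrix (Fin 2) (Fin 2) ℂ) +
              vecQuat ((((W (Site.shift (e.1 - Pi.single ν 1) e.2, ν))⁻¹ * (W (e.1 - Pi.single ν 1, e.2))⁻¹ * W (e.1 - Pi.single ν 1, ν))⁻¹ : (Matrix.specialUnitaryGroup (Fin 2) ℂ)) : Matrix (Fin 2) (Fin 2) ℂ))‖ ≤ 2 * ((d - 1 : ℕ) : ℝ) := by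
  have hcard : (((Finset.univ.erase e.2).card : ℕ) : ℝ) = ((d - 1 : ℕ) : ℝ) := by
    rw [Finset.card_erase_of_mem (Finset.mem_univ _), Finset.card_univ, Fintype.card_fin]
  refine (norm_sum_le _ _).trans ?_
  calc ∑ ν ∈ Finset.univ.erase e.2, ‖vecQuat (((W (Site.shift e.1 e.2, ν) * (W (Site.shift e.1 ν, e.2))⁻¹ *
            (W (e.1, ν))⁻¹)⁻¹ : (Matrix.specialUnitaryGroup (Fin 2) ℂ)) : Matrix (Fin 2) (Fin 2) ℂ) +
          vecQuat ((((W (Site.shift (e.1 - Pi.single ν 1) e.2, ν))⁻¹ * (W (e.1 - Pi.single ν 1, e.2))⁻¹ *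
            W (e.1 - Pi.single ν 1, ν))⁻¹ : (Matrix.specialUnitaryGroup (Fin 2) ℂ)) : Matrix (Fin 2) (Fin 2) ℂ)‖
      ≤ ∑ ν ∈ Finset.univ.erase e.2, (2 : ℝ) := Finset.sum_le_sum fun ν _ =>
        (norm_add_le _ _).trans (by rw [norm_vecQuat_of_mem, norm_vecQuat_of_mem]; norm_num)
    _ = 2 * ((d - 1 : ℕ) : ℝ) := by rw [Finset.sum_const, nsmul_eq_mul, hcard, mul_comm]

/-- `J_e` is a continuous function of the field. -/
theorem continuous_stapleJ (e : Edge d L) :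
    Continuous fun W : GaugeConfig d L ((Matrix.specialUnitaryGroup (Fin 2) ℂ)) => ∑ ν ∈ Finset.univ.erase e.2,
            (vecQuat (((W (Site.shift e.1 e.2, ν) * (W (Site.shift e.1 ν, e.2))⁻¹ * (W (e.1, ν))⁻¹)⁻¹ : (Matrix.specialUnitaryGroup (Fin 2) ℂ)) : Matrix (Fin 2) (Fin 2) ℂ) +
              vecQuat ((((W (Site.shift (e.1 - Pi.single ν 1) e.2, ν))⁻¹ * (W (e.1 - Pi.single ν 1, e.2))⁻¹ * W (e.1 - Pi.single ν 1, ν))⁻¹ : (Matrix.specialUnitaryGroup (Fin 2) ℂ)) : Matrix (Fin 2) (Fin 2) ℂ)) := by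
  have hW : ∀ j : Edge d L,
      Continuous fun W : GaugeConfig d L ((Matrix.specialUnitaryGroup (Fin 2) ℂ)) => W j :=
    fun j => continuous_apply j
  refine continuous_finsetSum _ fun ν _ => ?_
  refine (continuous_vecQuat_coe.comp ?_).add (continuous_vecQuat_coe.comp ?_)
  · exact (((hW (Site.shift e.1 e.2, ν)).mul (hW (Site.shift e.1 ν, e.2)).inv).mul
      (hW (e.1, ν)).inv).inv
  · exact (((hW (Site.shift (e.1 - Pi.single ν 1) e.2, ν)).inv.mul
      (hW (e.1 - Pi.single ν 1, e.2)).inv).mul (hW (e.1 - Pi.single ν 1, ν))).inv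

end Staple

/-! ## The sub-step is a certified coupling layer -/

section Substep

variable [DecidableEq X] (χ : Site d L → X) [NeZero L]

/-- **The masked `SU(2)` Wilson-flow Euler sub-step (quaternion form) is a certified coupling
layer of the gauge field.**  Proper colouring `χ`, direction `μ`, class `b`, step `ε` inside the
refusal rule `2(d−1)|ε| < 1`.  The sub-step computed from the full field — active links kicked
towards their conjugate staple sums, frozen links unchanged — is measurable and bijective, and
`HasJacobian (⊗_e haarProbability SU(2)) _ (∏_active j̃_e)` with the product of the repaired
per-link densities `j̃_e(V) = kickJac (ε‖J_e‖) 2 (angle J_e (vecQuat V_e))` (poles: `(1 − ε‖J_e‖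
cos θ)³`), which is positive and measurable. -/
theorem su2WilsonFlowLOSubstep_certified
    (hχ : ∀ (x : Site d L) (i : Fin d), χ (x.shift i) ≠ χ x) (μ : Fin d) (b : X) {ε : ℝ}
    (hε : |ε| * (2 * ((d - 1 : ℕ) : ℝ)) < 1) :
    Measurable (fun (V : GaugeConfig d L ((Matrix.specialUnitaryGroup (Fin 2) ℂ))) (e : Edge d L) =>
        if e.2 = μ ∧ χ e.1 = b then
          gaussUnit (geodesicKick ε (∑ ν ∈ Finset.univ.erase e.2,
            (vecQuat (((V (Site.shift e.1 e.2, ν) * (V (Site.shift e.1 ν, e.2))⁻¹ * (V (e.1, ν))⁻¹)⁻¹ : (Matrix.specialUnitaryGroup (Fin 2) ℂ)) : Matrix (Fin 2) (Fin 2) ℂ) +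
              vecQuat ((((V (Site.shift (e.1 - Pi.single ν 1) e.2, ν))⁻¹ * (V (e.1 - Pi.single ν 1, e.2))⁻¹ * V (e.1 - Pi.single ν 1, ν))⁻¹ : (Matrix.specialUnitaryGroup (Fin 2) ℂ)) : Matrix (Fin 2) (Fin 2) ℂ)))
            (vecQuat ((V e : (Matrix.specialUnitaryGroup (Fin 2) ℂ)) : Matrix (Fin 2) (Fin 2) ℂ)))
        else V e) ∧
    Function.Bijective (fun (V : GaugeConfig d L ((Matrix.specialUnitaryGroup (Fin 2) ℂ))) (e : Edge d L) =>
        if e.2 = μ ∧ χ e.1 = b then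
          gaussUnit (geodesicKick ε (∑ ν ∈ Finset.univ.erase e.2,
            (vecQuat (((V (Site.shift e.1 e.2, ν) * (V (Site.shift e.1 ν, e.2))⁻¹ * (V (e.1, ν))⁻¹)⁻¹ : (Matrix.specialUnitaryGroup (Fin 2) ℂ)) : Matrix (Fin 2) (Fin 2) ℂ) +
              vecQuat ((((V (Site.shift (e.1 - Pi.single ν 1) e.2, ν))⁻¹ * (V (e.1 - Pi.single ν 1, e.2))⁻¹ * V (e.1 - Pi.single ν 1, ν))⁻¹ : (Matrix.specialUnitaryGroup (Fin 2) ℂ)) : Matrix (Fin 2) (Fin 2) ℂ)))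
            (vecQuat ((V e : (Matrix.specialUnitaryGroup (Fin 2) ℂ)) : Matrix (Fin 2) (Fin 2) ℂ)))
        else V e) ∧
    HasJacobian (Measure.pi fun _ : Edge d L => haarProbability ((Matrix.specialUnitaryGroup (Fin 2) ℂ)))
      (fun (V : GaugeConfig d L ((Matrix.specialUnitaryGroup (Fin 2) ℂ))) (e : Edge d L) =>
        if e.2 = μ ∧ χ e.1 = b then
          gaussUnit (geodesicKick ε (∑ ν ∈ Finset.univ.erase e.2,
            (vecQuat (((V (Site.shift e.1 e.2, ν) * (V (Site.shift e.1 ν, e.2))⁻¹ * (V (e.1, ν))⁻¹)⁻¹ : (Matrix.specialUnitaryGroup (Fin 2) ℂ)) : Matrix (Fin 2) (Fin 2) ℂ) +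
              vecQuat ((((V (Site.shift (e.1 - Pi.single ν 1) e.2, ν))⁻¹ * (V (e.1 - Pi.single ν 1, e.2))⁻¹ * V (e.1 - Pi.single ν 1, ν))⁻¹ : (Matrix.specialUnitaryGroup (Fin 2) ℂ)) : Matrix (Fin 2) (Fin 2) ℂ)))
            (vecQuat ((V e : (Matrix.specialUnitaryGroup (Fin 2) ℂ)) : Matrix (Fin 2) (Fin 2) ℂ)))
        else V e)
      (fun V => ENNReal.ofReal (∏ a : {e : Edge d L // e.2 = μ ∧ χ e.1 = b},
          (if Real.sin (angle (∑ ν ∈ Finset.univ.erase a.1.2,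
            (vecQuat (((V (Site.shift a.1.1 a.1.2, ν) * (V (Site.shift a.1.1 ν, a.1.2))⁻¹ * (V (a.1.1, ν))⁻¹)⁻¹ : (Matrix.specialUnitaryGroup (Fin 2) ℂ)) : Matrix (Fin 2) (Fin 2) ℂ) +
              vecQuat ((((V (Site.shift (a.1.1 - Pi.single ν 1) a.1.2, ν))⁻¹ * (V (a.1.1 - Pi.single ν 1, a.1.2))⁻¹ * V (a.1.1 - Pi.single ν 1, ν))⁻¹ : (Matrix.specialUnitaryGroup (Fin 2) ℂ)) : Matrix (Fin 2) (Fin 2) ℂ))) (vecQuat ((V a.1 : (Matrix.specialUnitaryGroup (Fin 2) ℂ)) : Matrix (Fin 2) (Fin 2) ℂ))) = 0 then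
            (1 - ε * ‖(∑ ν ∈ Finset.univ.erase a.1.2,
            (vecQuat (((V (Site.shift a.1.1 a.1.2, ν) * (V (Site.shift a.1.1 ν, a.1.2))⁻¹ * (V (a.1.1, ν))⁻¹)⁻¹ : (Matrix.specialUnitaryGroup (Fin 2) ℂ)) : Matrix (Fin 2) (Fin 2) ℂ) +
              vecQuat ((((V (Site.shift (a.1.1 - Pi.single ν 1) a.1.2, ν))⁻¹ * (V (a.1.1 - Pi.single ν 1, a.1.2))⁻¹ * V (a.1.1 - Pi.single ν 1, ν))⁻¹ : (Matrix.specialUnitaryGroup (Fin 2) ℂ)) : Matrix (Fin 2) (Fin 2) ℂ)))‖ * Real.cos (angle (∑ ν ∈ Finset.univ.erase a.1.2,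
            (vecQuat (((V (Site.shift a.1.1 a.1.2, ν) * (V (Site.shift a.1.1 ν, a.1.2))⁻¹ * (V (a.1.1, ν))⁻¹)⁻¹ : (Matrix.specialUnitaryGroup (Fin 2) ℂ)) : Matrix (Fin 2) (Fin 2) ℂ) +
              vecQuat ((((V (Site.shift (a.1.1 - Pi.single ν 1) a.1.2, ν))⁻¹ * (V (a.1.1 - Pi.single ν 1, a.1.2))⁻¹ * V (a.1.1 - Pi.single ν 1, ν))⁻¹ : (Matrix.specialUnitaryGroup (Fin 2) ℂ)) : Matrix (Fin 2) (Fin 2) ℂ))) (vecQuat ((V a.1 : (Matrix.specialUnitaryGroup (Fin 2) ℂ)) : Matrix (Fin 2) (Fin 2) ℂ)))) ^ 3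
          else kickJac (ε * ‖(∑ ν ∈ Finset.univ.erase a.1.2,
            (vecQuat (((V (Site.shift a.1.1 a.1.2, ν) * (V (Site.shift a.1.1 ν, a.1.2))⁻¹ * (V (a.1.1, ν))⁻¹)⁻¹ : (Matrix.specialUnitaryGroup (Fin 2) ℂ)) : Matrix (Fin 2) (Fin 2) ℂ) +
              vecQuat ((((V (Site.shift (a.1.1 - Pi.single ν 1) a.1.2, ν))⁻¹ * (V (a.1.1 - Pi.single ν 1, a.1.2))⁻¹ * V (a.1.1 - Pi.single ν 1, ν))⁻¹ : (Matrix.specialUnitaryGroup (Fin 2) ℂ)) : Matrix (Fin 2) (Fin 2) ℂ)))‖) 2 (angle (∑ ν ∈ Finset.univ.erase a.1.2,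
            (vecQuat (((V (Site.shift a.1.1 a.1.2, ν) * (V (Site.shift a.1.1 ν, a.1.2))⁻¹ * (V (a.1.1, ν))⁻¹)⁻¹ : (Matrix.specialUnitaryGroup (Fin 2) ℂ)) : Matrix (Fin 2) (Fin 2) ℂ) +
              vecQuat ((((V (Site.shift (a.1.1 - Pi.single ν 1) a.1.2, ν))⁻¹ * (V (a.1.1 - Pi.single ν 1, a.1.2))⁻¹ * V (a.1.1 - Pi.single ν 1, ν))⁻¹ : (Matrix.specialUnitaryGroup (Fin 2) ℂ)) : Matrix (Fin 2) (Fin 2) ℂ))) (vecQuat ((V a.1 : (Matrix.specialUnitaryGroup (Fin 2) ℂ)) : Matrix (Fin 2) (Fin 2) ℂ)))))) ∧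
    (∀ V : GaugeConfig d L ((Matrix.specialUnitaryGroup (Fin 2) ℂ)), 0 < ∏ a : {e : Edge d L // e.2 = μ ∧ χ e.1 = b},
          (if Real.sin (angle (∑ ν ∈ Finset.univ.erase a.1.2,
            (vecQuat (((V (Site.shift a.1.1 a.1.2, ν) * (V (Site.shift a.1.1 ν, a.1.2))⁻¹ * (V (a.1.1, ν))⁻¹)⁻¹ : (Matrix.specialUnitaryGroup (Fin 2) ℂ)) : Matrix (Fin 2) (Fin 2) ℂ) +
              vecQuat ((((V (Site.shift (a.1.1 - Pi.single ν 1) a.1.2, ν))⁻¹ * (V (a.1.1 - Pi.single ν 1, a.1.2))⁻¹ * V (a.1.1 - Pi.single ν 1, ν))⁻¹ : (Matrix.specialUnitaryGroup (Fin 2) ℂ)) : Matrix (Fin 2) (Fin 2) ℂ))) (vecQuat ((V a.1 : (Matrix.specialUnitaryGroup (Fin 2) ℂ)) : Matrix (Fin 2) (Fin 2) ℂ))) = 0 then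
            (1 - ε * ‖(∑ ν ∈ Finset.univ.erase a.1.2,
            (vecQuat (((V (Site.shift a.1.1 a.1.2, ν) * (V (Site.shift a.1.1 ν, a.1.2))⁻¹ * (V (a.1.1, ν))⁻¹)⁻¹ : (Matrix.specialUnitaryGroup (Fin 2) ℂ)) : Matrix (Fin 2) (Fin 2) ℂ) +
              vecQuat ((((V (Site.shift (a.1.1 - Pi.single ν 1) a.1.2, ν))⁻¹ * (V (a.1.1 - Pi.single ν 1, a.1.2))⁻¹ * V (a.1.1 - Pi.single ν 1, ν))⁻¹ : (Matrix.specialUnitaryGroup (Fin 2) ℂ)) : Matrix (Fin 2) (Fin 2) ℂ)))‖ * Real.cos (angle (∑ ν ∈ Finset.univ.erase a.1.2,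
            (vecQuat (((V (Site.shift a.1.1 a.1.2, ν) * (V (Site.shift a.1.1 ν, a.1.2))⁻¹ * (V (a.1.1, ν))⁻¹)⁻¹ : (Matrix.specialUnitaryGroup (Fin 2) ℂ)) : Matrix (Fin 2) (Fin 2) ℂ) +
              vecQuat ((((V (Site.shift (a.1.1 - Pi.single ν 1) a.1.2, ν))⁻¹ * (V (a.1.1 - Pi.single ν 1, a.1.2))⁻¹ * V (a.1.1 - Pi.single ν 1, ν))⁻¹ : (Matrix.specialUnitaryGroup (Fin 2) ℂ)) : Matrix (Fin 2) (Fin 2) ℂ))) (vecQuat ((V a.1 : (Matrix.specialUnitaryGroup (Fin 2) ℂ)) : Matrix (Fin 2) (Fin 2) ℂ)))) ^ 3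
          else kickJac (ε * ‖(∑ ν ∈ Finset.univ.erase a.1.2,
            (vecQuat (((V (Site.shift a.1.1 a.1.2, ν) * (V (Site.shift a.1.1 ν, a.1.2))⁻¹ * (V (a.1.1, ν))⁻¹)⁻¹ : (Matrix.specialUnitaryGroup (Fin 2) ℂ)) : Matrix (Fin 2) (Fin 2) ℂ) +
              vecQuat ((((V (Site.shift (a.1.1 - Pi.single ν 1) a.1.2, ν))⁻¹ * (V (a.1.1 - Pi.single ν 1, a.1.2))⁻¹ * V (a.1.1 - Pi.single ν 1, ν))⁻¹ : (Matrix.specialUnitaryGroup (Fin 2) ℂ)) : Matrix (Fin 2) (Fin 2) ℂ)))‖) 2 (angle (∑ ν ∈ Finset.univ.erase a.1.2,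
            (vecQuat (((V (Site.shift a.1.1 a.1.2, ν) * (V (Site.shift a.1.1 ν, a.1.2))⁻¹ * (V (a.1.1, ν))⁻¹)⁻¹ : (Matrix.specialUnitaryGroup (Fin 2) ℂ)) : Matrix (Fin 2) (Fin 2) ℂ) +
              vecQuat ((((V (Site.shift (a.1.1 - Pi.single ν 1) a.1.2, ν))⁻¹ * (V (a.1.1 - Pi.single ν 1, a.1.2))⁻¹ * V (a.1.1 - Pi.single ν 1, ν))⁻¹ : (Matrix.specialUnitaryGroup (Fin 2) ℂ)) : Matrix (Fin 2) (Fin 2) ℂ))) (vecQuat ((V a.1 : (Matrix.specialUnitaryGroup (Fin 2) ℂ)) : Matrix (Fin 2) (Fin 2) ℂ))))) ∧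
    Measurable fun V : GaugeConfig d L ((Matrix.specialUnitaryGroup (Fin 2) ℂ)) => ∏ a : {e : Edge d L // e.2 = μ ∧ χ e.1 = b},
          (if Real.sin (angle (∑ ν ∈ Finset.univ.erase a.1.2,
            (vecQuat (((V (Site.shift a.1.1 a.1.2, ν) * (V (Site.shift a.1.1 ν, a.1.2))⁻¹ * (V (a.1.1, ν))⁻¹)⁻¹ : (Matrix.specialUnitaryGroup (Fin 2) ℂ)) : Matrix (Fin 2) (Fin 2) ℂ) +
              vecQuat ((((V (Site.shift (a.1.1 - Pi.single ν 1) a.1.2, ν))⁻¹ * (V (a.1.1 - Pi.single ν 1, a.1.2))⁻¹ * V (a.1.1 - Pi.single ν 1, ν))⁻¹ : (Matrix.specialUnitaryGroup (Fin 2) ℂ)) : Matrix (Fin 2) (Fin 2) ℂ))) (vecQuat ((V a.1 : (Matrix.specialUnitaryGroup (Fin 2) ℂ)) : Matrix (Fin 2) (Fin 2) ℂ))) = 0 then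
            (1 - ε * ‖(∑ ν ∈ Finset.univ.erase a.1.2,
            (vecQuat (((V (Site.shift a.1.1 a.1.2, ν) * (V (Site.shift a.1.1 ν, a.1.2))⁻¹ * (V (a.1.1, ν))⁻¹)⁻¹ : (Matrix.specialUnitaryGroup (Fin 2) ℂ)) : Matrix (Fin 2) (Fin 2) ℂ) +
              vecQuat ((((V (Site.shift (a.1.1 - Pi.single ν 1) a.1.2, ν))⁻¹ * (V (a.1.1 - Pi.single ν 1, a.1.2))⁻¹ * V (a.1.1 - Pi.single ν 1, ν))⁻¹ : (Matrix.specialUnitaryGroup (Fin 2) ℂ)) : Matrix (Fin 2) (Fin 2) ℂ)))‖ * Real.cos (angle (∑ ν ∈ Finset.univ.erase a.1.2,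
            (vecQuat (((V (Site.shift a.1.1 a.1.2, ν) * (V (Site.shift a.1.1 ν, a.1.2))⁻¹ * (V (a.1.1, ν))⁻¹)⁻¹ : (Matrix.specialUnitaryGroup (Fin 2) ℂ)) : Matrix (Fin 2) (Fin 2) ℂ) +
              vecQuat ((((V (Site.shift (a.1.1 - Pi.single ν 1) a.1.2, ν))⁻¹ * (V (a.1.1 - Pi.single ν 1, a.1.2))⁻¹ * V (a.1.1 - Pi.single ν 1, ν))⁻¹ : (Matrix.specialUnitaryGroup (Fin 2) ℂ)) : Matrix (Fin 2) (Fin 2) ℂ))) (vecQuat ((V a.1 : (Matrix.specialUnitaryGroup (Fin 2) ℂ)) : Matrix (Fin 2) (Fin 2) ℂ)))) ^ 3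
          else kickJac (ε * ‖(∑ ν ∈ Finset.univ.erase a.1.2,
            (vecQuat (((V (Site.shift a.1.1 a.1.2, ν) * (V (Site.shift a.1.1 ν, a.1.2))⁻¹ * (V (a.1.1, ν))⁻¹)⁻¹ : (Matrix.specialUnitaryGroup (Fin 2) ℂ)) : Matrix (Fin 2) (Fin 2) ℂ) +
              vecQuat ((((V (Site.shift (a.1.1 - Pi.single ν 1) a.1.2, ν))⁻¹ * (V (a.1.1 - Pi.single ν 1, a.1.2))⁻¹ * V (a.1.1 - Pi.single ν 1, ν))⁻¹ : (Matrix.specialUnitaryGroup (Fin 2) ℂ)) : Matrix (Fin 2) (Fin 2) ℂ)))‖) 2 (angle (∑ ν ∈ Finset.univ.erase a.1.2,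
            (vecQuat (((V (Site.shift a.1.1 a.1.2, ν) * (V (Site.shift a.1.1 ν, a.1.2))⁻¹ * (V (a.1.1, ν))⁻¹)⁻¹ : (Matrix.specialUnitaryGroup (Fin 2) ℂ)) : Matrix (Fin 2) (Fin 2) ℂ) +
              vecQuat ((((V (Site.shift (a.1.1 - Pi.single ν 1) a.1.2, ν))⁻¹ * (V (a.1.1 - Pi.single ν 1, a.1.2))⁻¹ * V (a.1.1 - Pi.single ν 1, ν))⁻¹ : (Matrix.specialUnitaryGroup (Fin 2) ℂ)) : Matrix (Fin 2) (Fin 2) ℂ))) (vecQuat ((V a.1 : (Matrix.specialUnitaryGroup (Fin 2) ℂ)) : Matrix (Fin 2) (Fin 2) ℂ)))) := by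
  classical
  -- proof-local abbreviations
  set JS : GaugeConfig d L ((Matrix.specialUnitaryGroup (Fin 2) ℂ)) → Edge d L → R4 := fun W e =>
    ∑ ν ∈ Finset.univ.erase e.2,
            (vecQuat (((W (Site.shift e.1 e.2, ν) * (W (Site.shift e.1 ν, e.2))⁻¹ * (W (e.1, ν))⁻¹)⁻¹ : (Matrix.specialUnitaryGroup (Fin 2) ℂ)) : Matrix (Fin 2) (Fin 2) ℂ) +
              vecQuat ((((W (Site.shift (e.1 - Pi.single ν 1) e.2, ν))⁻¹ * (W (e.1 - Pi.single ν 1, e.2))⁻¹ * W (e.1 - Pi.single ν 1, ν))⁻¹ : (Matrix.specialUnitaryGroup (Fin 2) ℂ)) : Matrix (Fin 2) (Fin 2) ℂ)) with hJS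
  set EXT : {e : Edge d L // e.2 = μ ∧ χ e.1 = b} →
      ({e : Edge d L // ¬(e.2 = μ ∧ χ e.1 = b)} → (Matrix.specialUnitaryGroup (Fin 2) ℂ)) → (Matrix.specialUnitaryGroup (Fin 2) ℂ) →
      GaugeConfig d L ((Matrix.specialUnitaryGroup (Fin 2) ℂ)) :=
    fun a y g j => if h : j.2 = μ ∧ χ j.1 = b then (if j = a.1 then g else 1) else y ⟨j, h⟩ with hEXT
  set ψ : {e : Edge d L // e.2 = μ ∧ χ e.1 = b} →
      ({e : Edge d L // ¬(e.2 = μ ∧ χ e.1 = b)} → (Matrix.specialUnitaryGroup (Fin 2) ℂ)) → (Matrix.specialUnitaryGroup (Fin 2) ℂ) → (Matrix.specialUnitaryGroup (Fin 2) ℂ) :=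
    fun a y g => gaussUnit (geodesicKick ε (JS (EXT a y 1) a.1) (vecQuat ((g : (Matrix.specialUnitaryGroup (Fin 2) ℂ)) : Matrix (Fin 2) (Fin 2) ℂ)))
    with hψ
  set jac : {e : Edge d L // e.2 = μ ∧ χ e.1 = b} →
      ({e : Edge d L // ¬(e.2 = μ ∧ χ e.1 = b)} → (Matrix.specialUnitaryGroup (Fin 2) ℂ)) → (Matrix.specialUnitaryGroup (Fin 2) ℂ) → ℝ :=
    fun a y g =>
      if Real.sin (angle (JS (EXT a y 1) a.1) (vecQuat ((g : (Matrix.specialUnitaryGroup (Fin 2) ℂ)) : Matrix (Fin 2) (Fin 2) ℂ))) = 0 then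
        (1 - ε * ‖JS (EXT a y 1) a.1‖ *
          Real.cos (angle (JS (EXT a y 1) a.1) (vecQuat ((g : (Matrix.specialUnitaryGroup (Fin 2) ℂ)) : Matrix (Fin 2) (Fin 2) ℂ)))) ^ 3
      else kickJac (ε * ‖JS (EXT a y 1) a.1‖) 2
        (angle (JS (EXT a y 1) a.1) (vecQuat ((g : (Matrix.specialUnitaryGroup (Fin 2) ℂ)) : Matrix (Fin 2) (Fin 2) ℂ))) with hjac
  -- the field at an active link does not read the active links
  have hJloc : ∀ (a : {e : Edge d L // e.2 = μ ∧ χ e.1 = b}) (V : GaugeConfig d L ((Matrix.specialUnitaryGroup (Fin 2) ℂ))),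
      JS (EXT a (fun f => V f) 1) a.1 = JS V a.1 := fun a V =>
    stapleJ_local χ hχ a.2 fun j hj => by
      simp only [hEXT]
      rw [dif_neg hj]
  -- the refusal rule gives `|ε| ‖J‖ < 1`
  have hκ : ∀ (W : GaugeConfig d L ((Matrix.specialUnitaryGroup (Fin 2) ℂ))) (e : Edge d L), |ε| * ‖JS W e‖ < 1 := fun W e =>
    lt_of_le_of_lt (mul_le_mul_of_nonneg_left (norm_stapleJ_le W e) (abs_nonneg ε)) hε
  -- continuity / measurability of the field
  have hJSc : ∀ e : Edge d L, Continuous fun W : GaugeConfig d L ((Matrix.specialUnitaryGroup (Fin 2) ℂ)) => JS W e :=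
    fun e => continuous_stapleJ e
  have hEXTc : ∀ a : {e : Edge d L // e.2 = μ ∧ χ e.1 = b},
      Continuous fun y : {e : Edge d L // ¬(e.2 = μ ∧ χ e.1 = b)} → (Matrix.specialUnitaryGroup (Fin 2) ℂ) => EXT a y 1 := by
    intro a
    refine continuous_pi fun j => ?_
    by_cases hj : j.2 = μ ∧ χ j.1 = b
    · simp only [hEXT, dif_pos hj]
      exact continuous_const
    · simp only [hEXT, dif_neg hj]
      exact continuous_apply _
  have hJSm : ∀ a : {e : Edge d L // e.2 = μ ∧ χ e.1 = b},
      Measurable fun q : (Matrix.specialUnitaryGroup (Fin 2) ℂ) × ({e : Edge d L // ¬(e.2 = μ ∧ χ e.1 = b)} → (Matrix.specialUnitaryGroup (Fin 2) ℂ)) =>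
        JS (EXT a q.2 1) a.1 :=
    fun a => (((hJSc a.1).comp' (hEXTc a)).comp' continuous_snd).measurable
  -- the coupling layer IS the sub-step
  have hcf : coupleFun (fun e : Edge d L => e.2 = μ ∧ χ e.1 = b) ψ =
      fun (V : GaugeConfig d L ((Matrix.specialUnitaryGroup (Fin 2) ℂ))) (e : Edge d L) =>
        if e.2 = μ ∧ χ e.1 = b then
          gaussUnit (geodesicKick ε (∑ ν ∈ Finset.univ.erase e.2,
            (vecQuat (((V (Site.shift e.1 e.2, ν) * (V (Site.shift e.1 ν, e.2))⁻¹ * (V (e.1, ν))⁻¹)⁻¹ : (Matrix.specialUnitaryGroup (Fin 2) ℂ)) : Matrix (Fin 2) (Fin 2) ℂ) +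
              vecQuat ((((V (Site.shift (e.1 - Pi.single ν 1) e.2, ν))⁻¹ * (V (e.1 - Pi.single ν 1, e.2))⁻¹ * V (e.1 - Pi.single ν 1, ν))⁻¹ : (Matrix.specialUnitaryGroup (Fin 2) ℂ)) : Matrix (Fin 2) (Fin 2) ℂ)))
            (vecQuat ((V e : (Matrix.specialUnitaryGroup (Fin 2) ℂ)) : Matrix (Fin 2) (Fin 2) ℂ)))
        else V e := by
    funext V e
    by_cases he : e.2 = μ ∧ χ e.1 = b
    · rw [coupleFun_apply_of_pos (p := fun e : Edge d L => e.2 = μ ∧ χ e.1 = b) ψ V he, if_pos he]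
      simp only [hψ]
      rw [hJloc ⟨e, he⟩ V]
    · rw [coupleFun_apply_of_neg (p := fun e : Edge d L => e.2 = μ ∧ χ e.1 = b) ψ V he, if_neg he]
  -- per-link certificates
  have hJ1 : ∀ a y, HasJacobian (haarProbability ((Matrix.specialUnitaryGroup (Fin 2) ℂ))) (ψ a y)
      fun g => ENNReal.ofReal (jac a y g) :=
    fun a y => hasJacobian_su2Kick_fix (hκ (EXT a y 1) a.1).le
  have hψm : ∀ a, Measurable fun q : (Matrix.specialUnitaryGroup (Fin 2) ℂ) × ({e : Edge d L // ¬(e.2 = μ ∧ χ e.1 = b)} → (Matrix.specialUnitaryGroup (Fin 2) ℂ)) =>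
      ψ a q.2 q.1 := by
    intro a
    have hfun : (fun q : (Matrix.specialUnitaryGroup (Fin 2) ℂ) × ({e : Edge d L // ¬(e.2 = μ ∧ χ e.1 = b)} → (Matrix.specialUnitaryGroup (Fin 2) ℂ)) => ψ a q.2 q.1) =
        (fun r : ((Matrix.specialUnitaryGroup (Fin 2) ℂ)) × R4 =>
          gaussUnit (geodesicKick ε r.2 (vecQuat ((r.1 : (Matrix.specialUnitaryGroup (Fin 2) ℂ)) : Matrix (Fin 2) (Fin 2) ℂ)))) ∘
          (fun q : (Matrix.specialUnitaryGroup (Fin 2) ℂ) × ({e : Edge d L // ¬(e.2 = μ ∧ χ e.1 = b)} → (Matrix.specialUnitaryGroup (Fin 2) ℂ)) => (q.1, JS (EXT a q.2 1) a.1)) := by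
      funext q
      simp only [Function.comp_apply, hψ]
    rw [hfun]
    exact (measurable_su2Kick₂ ε).comp (measurable_fst.prodMk (hJSm a))
  have hjm : ∀ a, Measurable fun q : (Matrix.specialUnitaryGroup (Fin 2) ℂ) × ({e : Edge d L // ¬(e.2 = μ ∧ χ e.1 = b)} → (Matrix.specialUnitaryGroup (Fin 2) ℂ)) =>
      jac a q.2 q.1 := by
    intro a
    have hfun : (fun q : (Matrix.specialUnitaryGroup (Fin 2) ℂ) × ({e : Edge d L // ¬(e.2 = μ ∧ χ e.1 = b)} → (Matrix.specialUnitaryGroup (Fin 2) ℂ)) => jac a q.2 q.1) =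
        (fun r : ((Matrix.specialUnitaryGroup (Fin 2) ℂ)) × R4 =>
          (if Real.sin (angle r.2 (vecQuat ((r.1 : (Matrix.specialUnitaryGroup (Fin 2) ℂ)) : Matrix (Fin 2) (Fin 2) ℂ))) = 0 then
              (1 - ε * ‖r.2‖ * Real.cos (angle r.2 (vecQuat ((r.1 : (Matrix.specialUnitaryGroup (Fin 2) ℂ)) : Matrix (Fin 2) (Fin 2) ℂ)))) ^ 3
            else kickJac (ε * ‖r.2‖) 2 (angle r.2 (vecQuat ((r.1 : (Matrix.specialUnitaryGroup (Fin 2) ℂ)) : Matrix (Fin 2) (Fin 2) ℂ))))) ∘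
          (fun q : (Matrix.specialUnitaryGroup (Fin 2) ℂ) × ({e : Edge d L // ¬(e.2 = μ ∧ χ e.1 = b)} → (Matrix.specialUnitaryGroup (Fin 2) ℂ)) => (q.1, JS (EXT a q.2 1) a.1)) := by
      funext q
      simp only [Function.comp_apply, hjac]
    rw [hfun]
    exact (measurable_su2KickJacFix₂ ε).comp (measurable_fst.prodMk (hJSm a))
  have hj0 : ∀ a y g, 0 ≤ jac a y g := fun a y g => (su2KickJacFix_pos (hκ (EXT a y 1) a.1) g).le
  have hHJ := hasJacobian_coupleFun (p := fun e : Edge d L => e.2 = μ ∧ χ e.1 = b)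
    (haarProbability ((Matrix.specialUnitaryGroup (Fin 2) ℂ))) hψm hjm hJ1 hj0
  -- the layer Jacobian is the booked product
  have hcj : (fun U : GaugeConfig d L ((Matrix.specialUnitaryGroup (Fin 2) ℂ)) => ENNReal.ofReal
      (coupleJac (fun e : Edge d L => e.2 = μ ∧ χ e.1 = b) jac U)) =
      fun V => ENNReal.ofReal (∏ a : {e : Edge d L // e.2 = μ ∧ χ e.1 = b},
          (if Real.sin (angle (∑ ν ∈ Finset.univ.erase a.1.2,
            (vecQuat (((V (Site.shift a.1.1 a.1.2, ν) * (V (Site.shift a.1.1 ν, a.1.2))⁻¹ * (V (a.1.1, ν))⁻¹)⁻¹ : (Matrix.specialUnitaryGroup (Fin 2) ℂ)) : Matrix (Fin 2) (Fin 2) ℂ) +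
              vecQuat ((((V (Site.shift (a.1.1 - Pi.single ν 1) a.1.2, ν))⁻¹ * (V (a.1.1 - Pi.single ν 1, a.1.2))⁻¹ * V (a.1.1 - Pi.single ν 1, ν))⁻¹ : (Matrix.specialUnitaryGroup (Fin 2) ℂ)) : Matrix (Fin 2) (Fin 2) ℂ))) (vecQuat ((V a.1 : (Matrix.specialUnitaryGroup (Fin 2) ℂ)) : Matrix (Fin 2) (Fin 2) ℂ))) = 0 then
            (1 - ε * ‖(∑ ν ∈ Finset.univ.erase a.1.2,
            (vecQuat (((V (Site.shift a.1.1 a.1.2, ν) * (V (Site.shift a.1.1 ν, a.1.2))⁻¹ * (V (a.1.1, ν))⁻¹)⁻¹ : (Matrix.specialUnitaryGroup (Fin 2) ℂ)) : Matrix (Fin 2) (Fin 2) ℂ) +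
              vecQuat ((((V (Site.shift (a.1.1 - Pi.single ν 1) a.1.2, ν))⁻¹ * (V (a.1.1 - Pi.single ν 1, a.1.2))⁻¹ * V (a.1.1 - Pi.single ν 1, ν))⁻¹ : (Matrix.specialUnitaryGroup (Fin 2) ℂ)) : Matrix (Fin 2) (Fin 2) ℂ)))‖ * Real.cos (angle (∑ ν ∈ Finset.univ.erase a.1.2,
            (vecQuat (((V (Site.shift a.1.1 a.1.2, ν) * (V (Site.shift a.1.1 ν, a.1.2))⁻¹ * (V (a.1.1, ν))⁻¹)⁻¹ : (Matrix.specialUnitaryGroup (Fin 2) ℂ)) : Matrix (Fin 2) (Fin 2) ℂ) +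
              vecQuat ((((V (Site.shift (a.1.1 - Pi.single ν 1) a.1.2, ν))⁻¹ * (V (a.1.1 - Pi.single ν 1, a.1.2))⁻¹ * V (a.1.1 - Pi.single ν 1, ν))⁻¹ : (Matrix.specialUnitaryGroup (Fin 2) ℂ)) : Matrix (Fin 2) (Fin 2) ℂ))) (vecQuat ((V a.1 : (Matrix.specialUnitaryGroup (Fin 2) ℂ)) : Matrix (Fin 2) (Fin 2) ℂ)))) ^ 3
          else kickJac (ε * ‖(∑ ν ∈ Finset.univ.erase a.1.2,
            (vecQuat (((V (Site.shift a.1.1 a.1.2, ν) * (V (Site.shift a.1.1 ν, a.1.2))⁻¹ * (V (a.1.1, ν))⁻¹)⁻¹ : (Matrix.specialUnitaryGroup (Fin 2) ℂ)) : Matrix (Fin 2) (Fin 2) ℂ) +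
              vecQuat ((((V (Site.shift (a.1.1 - Pi.single ν 1) a.1.2, ν))⁻¹ * (V (a.1.1 - Pi.single ν 1, a.1.2))⁻¹ * V (a.1.1 - Pi.single ν 1, ν))⁻¹ : (Matrix.specialUnitaryGroup (Fin 2) ℂ)) : Matrix (Fin 2) (Fin 2) ℂ)))‖) 2 (angle (∑ ν ∈ Finset.univ.erase a.1.2,
            (vecQuat (((V (Site.shift a.1.1 a.1.2, ν) * (V (Site.shift a.1.1 ν, a.1.2))⁻¹ * (V (a.1.1, ν))⁻¹)⁻¹ : (Matrix.specialUnitaryGroup (Fin 2) ℂ)) : Matrix (Fin 2) (Fin 2) ℂ) +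
              vecQuat ((((V (Site.shift (a.1.1 - Pi.single ν 1) a.1.2, ν))⁻¹ * (V (a.1.1 - Pi.single ν 1, a.1.2))⁻¹ * V (a.1.1 - Pi.single ν 1, ν))⁻¹ : (Matrix.specialUnitaryGroup (Fin 2) ℂ)) : Matrix (Fin 2) (Fin 2) ℂ))) (vecQuat ((V a.1 : (Matrix.specialUnitaryGroup (Fin 2) ℂ)) : Matrix (Fin 2) (Fin 2) ℂ))))) := by
    funext V
    refine congrArg ENNReal.ofReal ?_
    unfold coupleJac
    refine Finset.prod_congr rfl fun a _ => ?_
    simp only [hjac]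
    rw [hJloc a V]
  have hJprod_meas : Measurable fun V : GaugeConfig d L ((Matrix.specialUnitaryGroup (Fin 2) ℂ)) => ∏ a : {e : Edge d L // e.2 = μ ∧ χ e.1 = b},
          (if Real.sin (angle (∑ ν ∈ Finset.univ.erase a.1.2,
            (vecQuat (((V (Site.shift a.1.1 a.1.2, ν) * (V (Site.shift a.1.1 ν, a.1.2))⁻¹ * (V (a.1.1, ν))⁻¹)⁻¹ : (Matrix.specialUnitaryGroup (Fin 2) ℂ)) : Matrix (Fin 2) (Fin 2) ℂ) +
              vecQuat ((((V (Site.shift (a.1.1 - Pi.single ν 1) a.1.2, ν))⁻¹ * (V (a.1.1 - Pi.single ν 1, a.1.2))⁻¹ * V (a.1.1 - Pi.single ν 1, ν))⁻¹ : (Matrix.specialUnitaryGroup (Fin 2) ℂ)) : Matrix (Fin 2) (Fin 2) ℂ))) (vecQuat ((V a.1 : (Matrix.specialUnitaryGroup (Fin 2) ℂ)) : Matrix (Fin 2) (Fin 2) ℂ))) = 0 then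
            (1 - ε * ‖(∑ ν ∈ Finset.univ.erase a.1.2,
            (vecQuat (((V (Site.shift a.1.1 a.1.2, ν) * (V (Site.shift a.1.1 ν, a.1.2))⁻¹ * (V (a.1.1, ν))⁻¹)⁻¹ : (Matrix.specialUnitaryGroup (Fin 2) ℂ)) : Matrix (Fin 2) (Fin 2) ℂ) +
              vecQuat ((((V (Site.shift (a.1.1 - Pi.single ν 1) a.1.2, ν))⁻¹ * (V (a.1.1 - Pi.single ν 1, a.1.2))⁻¹ * V (a.1.1 - Pi.single ν 1, ν))⁻¹ : (Matrix.specialUnitaryGroup (Fin 2) ℂ)) : Matrix (Fin 2) (Fin 2) ℂ)))‖ * Real.cos (angle (∑ ν ∈ Finset.univ.erase a.1.2,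
            (vecQuat (((V (Site.shift a.1.1 a.1.2, ν) * (V (Site.shift a.1.1 ν, a.1.2))⁻¹ * (V (a.1.1, ν))⁻¹)⁻¹ : (Matrix.specialUnitaryGroup (Fin 2) ℂ)) : Matrix (Fin 2) (Fin 2) ℂ) +
              vecQuat ((((V (Site.shift (a.1.1 - Pi.single ν 1) a.1.2, ν))⁻¹ * (V (a.1.1 - Pi.single ν 1, a.1.2))⁻¹ * V (a.1.1 - Pi.single ν 1, ν))⁻¹ : (Matrix.specialUnitaryGroup (Fin 2) ℂ)) : Matrix (Fin 2) (Fin 2) ℂ))) (vecQuat ((V a.1 : (Matrix.specialUnitaryGroup (Fin 2) ℂ)) : Matrix (Fin 2) (Fin 2) ℂ)))) ^ 3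
          else kickJac (ε * ‖(∑ ν ∈ Finset.univ.erase a.1.2,
            (vecQuat (((V (Site.shift a.1.1 a.1.2, ν) * (V (Site.shift a.1.1 ν, a.1.2))⁻¹ * (V (a.1.1, ν))⁻¹)⁻¹ : (Matrix.specialUnitaryGroup (Fin 2) ℂ)) : Matrix (Fin 2) (Fin 2) ℂ) +
              vecQuat ((((V (Site.shift (a.1.1 - Pi.single ν 1) a.1.2, ν))⁻¹ * (V (a.1.1 - Pi.single ν 1, a.1.2))⁻¹ * V (a.1.1 - Pi.single ν 1, ν))⁻¹ : (Matrix.specialUnitaryGroup (Fin 2) ℂ)) : Matrix (Fin 2) (Fin 2) ℂ)))‖) 2 (angle (∑ ν ∈ Finset.univ.erase a.1.2,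
            (vecQuat (((V (Site.shift a.1.1 a.1.2, ν) * (V (Site.shift a.1.1 ν, a.1.2))⁻¹ * (V (a.1.1, ν))⁻¹)⁻¹ : (Matrix.specialUnitaryGroup (Fin 2) ℂ)) : Matrix (Fin 2) (Fin 2) ℂ) +
              vecQuat ((((V (Site.shift (a.1.1 - Pi.single ν 1) a.1.2, ν))⁻¹ * (V (a.1.1 - Pi.single ν 1, a.1.2))⁻¹ * V (a.1.1 - Pi.single ν 1, ν))⁻¹ : (Matrix.specialUnitaryGroup (Fin 2) ℂ)) : Matrix (Fin 2) (Fin 2) ℂ))) (vecQuat ((V a.1 : (Matrix.specialUnitaryGroup (Fin 2) ℂ)) : Matrix (Fin 2) (Fin 2) ℂ)))) := by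
    refine Finset.measurable_prod _ fun a _ => ?_
    have h1 : Measurable fun V : GaugeConfig d L ((Matrix.specialUnitaryGroup (Fin 2) ℂ)) => (V a.1, JS V a.1) :=
      (measurable_pi_apply _).prodMk (hJSc a.1).measurable
    have h2 : Measurable fun V : GaugeConfig d L ((Matrix.specialUnitaryGroup (Fin 2) ℂ)) =>
        (if Real.sin (angle (JS V a.1) (vecQuat ((V a.1 : (Matrix.specialUnitaryGroup (Fin 2) ℂ)) : Matrix (Fin 2) (Fin 2) ℂ))) = 0 then
            (1 - ε * ‖JS V a.1‖ * Real.cos (angle (JS V a.1) (vecQuat ((V a.1 : (Matrix.specialUnitaryGroup (Fin 2) ℂ)) : Matrix (Fin 2) (Fin 2) ℂ)))) ^ 3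
          else kickJac (ε * ‖JS V a.1‖) 2 (angle (JS V a.1) (vecQuat ((V a.1 : (Matrix.specialUnitaryGroup (Fin 2) ℂ)) : Matrix (Fin 2) (Fin 2) ℂ)))) := by
      have hfun : (fun V : GaugeConfig d L ((Matrix.specialUnitaryGroup (Fin 2) ℂ)) =>
          (if Real.sin (angle (JS V a.1) (vecQuat ((V a.1 : (Matrix.specialUnitaryGroup (Fin 2) ℂ)) : Matrix (Fin 2) (Fin 2) ℂ))) = 0 then
              (1 - ε * ‖JS V a.1‖ * Real.cos (angle (JS V a.1) (vecQuat ((V a.1 : (Matrix.specialUnitaryGroup (Fin 2) ℂ)) : Matrix (Fin 2) (Fin 2) ℂ)))) ^ 3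
            else kickJac (ε * ‖JS V a.1‖) 2 (angle (JS V a.1) (vecQuat ((V a.1 : (Matrix.specialUnitaryGroup (Fin 2) ℂ)) : Matrix (Fin 2) (Fin 2) ℂ))))) =
          (fun r : ((Matrix.specialUnitaryGroup (Fin 2) ℂ)) × R4 =>
            (if Real.sin (angle r.2 (vecQuat ((r.1 : (Matrix.specialUnitaryGroup (Fin 2) ℂ)) : Matrix (Fin 2) (Fin 2) ℂ))) = 0 then
                (1 - ε * ‖r.2‖ * Real.cos (angle r.2 (vecQuat ((r.1 : (Matrix.specialUnitaryGroup (Fin 2) ℂ)) : Matrix (Fin 2) (Fin 2) ℂ)))) ^ 3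
              else kickJac (ε * ‖r.2‖) 2 (angle r.2 (vecQuat ((r.1 : (Matrix.specialUnitaryGroup (Fin 2) ℂ)) : Matrix (Fin 2) (Fin 2) ℂ))))) ∘
            (fun V : GaugeConfig d L ((Matrix.specialUnitaryGroup (Fin 2) ℂ)) => (V a.1, JS V a.1)) := by
        funext V
        simp only [Function.comp_apply]
      rw [hfun]
      exact (measurable_su2KickJacFix₂ ε).comp h1
    exact h2
  refine ⟨?_, ?_, ?_, ?_, hJprod_meas⟩
  · rw [← hcf]
    exact hHJ.measurable
  · rw [← hcf, coupleFun_eq_conj]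
    exact (MeasurableEquiv.bijective _).comp ((bijective_maskedLayer (fun y a g => ψ a y g)
      fun y a => bijective_su2Kick (hκ (EXT a y 1) a.1).le).comp (MeasurableEquiv.bijective _))
  · rw [← hcf, ← hcj]
    exact hHJ
  · intro V
    exact Finset.prod_pos fun a _ => su2KickJacFix_pos (hκ V a.1) (V a.1)

end Substep

end Summit.Ventures.LatticeQCDFlow.Exactness
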